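import Summits.BirchSwinnertonDyer.BirchSwinnertonDyer.Theorems.PrintCf2RamifiedOffTYZGenusCharacter
import HarnessLib

/-!
# Route `PrintCf2`, crux stmt-BirchSwinnertonDyer-20509 `RamifiedOffTYZOfFacts` — `ρ(n) = 0` FREEZES THE HALF-GENERATOR: on the
# lower-half locus with `[E_n(ℚ) : φ_n(A_n(ℚ)) + E_n[2]] = 1` the whole group `Gal(ℍ′_n/K_n(i))` FIXES the genus point `P(n)`
# (cell `bsd-print-cf2`, LEAD of 20509 g11, line `offtyz-v7`, lineage cycle 12, sequel of `…GenusCharacter`; fact-free, Theses-free, no `def`)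

HONEST FRAMING (crux 20509 = `𝔅_ram → WAllCornerFTwoRamifiedOffTYZProved`, DECIDING, OPEN AS A CLASS): bookkeeping on
Tian–Yuan–Zhang's Theorem 3.5 main clause and Lemma 3.18 taken as HYPOTHESES on the displayed data, GZK by name, the W2 descent
kernel (`stub_S0'`, `stub_S1`, the twist maps `Θ_A`, `Θ_E`, `ψ_ℚ`), g3's valve file (`map_ΘA_sub_zsmul_half_isOfFinAddOrder`, p664829)
and this seat's `…GenusCharacter` (p726538).  Nothing is asserted; C⁺ = `stub_offTYZ_levelTwoScriptLExact` (= item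
stmt-BirchSwinnertonDyer-23431) stays open.

`ρ(n)` is the printed index `2^{ρ(n)} = [E_n(ℚ) : φ_n(A_n(ℚ)) + E_n[2]]` (`(rhoSubgroup n).index`); by the `x`-coordinate descent map
(Silverman X.4.9) `ρ(n) = 0` iff the generator's class `x(R) mod ℚ^{×2}` lies in `{1, −1, n, −n}` = the classes of `E_n[2]`.

* §1 `galPt_half_eq_of_rhoIndex_eq_one`: square-free ODD `n`, `rank E_n(ℚ) ≤ 1`, **`ρ(n) = 0`**, Lemma 3.18: every half `Q₁` of the
  twisted generator (`φ_H(Q₁) = ι Θ_E(R)`) is FIXED by every `g ∈ Aut_ℚ(ℍ′_n)` with `g(i) = i`, `g(√−n) = √−n`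
  (`Q₁ ≡ ±ι Θ_A(α₀)` modulo torsion by the half relation with `ρ = 0`, and `ι Θ_A(α₀)` is `K_n`-rational).  So the genus character
  `χ_{Q₁}` of `…GenusCharacter` vanishes on `Gal(ℍ′_n/K_n(i))` when `ρ(n) = 0`.
* §2 `galPt_genusPoint_eq_of_rhoIndex_eq_one_of_mem_line` / `…_of_two_dvd`: on the line `P(n) ≡ m·Q₁` — in particular on the LOWER-HALF
  locus of the jump-one class (GZK, Thm 3.5, integrality) — with `ρ(n) = 0`, **every `g ∈ Gal(ℍ′_n/K_n(i))` fixes `P(n)`**.  Consequently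
  (`not_galPt_genusPoint_ne_of_rhoIndex_eq_one_of_two_dvd`) NO Galois-motion door inside `ℍ′_n` (g4's p671505/p672160, this seat's
  p726233) can certify the upper half there: on `{ρ = 0} ∩ {2 ∣ 𝓛}` the digit `4 ∤ 𝓛(n)` is invisible to `Gal(ℍ′_n/K_n(i))`.
* §3 `levelTwo_iff_exists_galPt_genusPoint_ne_of_two_dvd`: conversely, given the lower half and ONE `g₀ ∈ Gal(ℍ′_n/K_n(i))` moving `Q₁`
  (which `ρ(n) = 1` supplies by Galois theory — `x(R) ∉ ⟨−1, n⟩ℚ^{×2}`, so `K_n(i, Q₁) ≠ K_n(i)`; kernel-owed, taken as a hypothesis),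
  **C⁺ at `n` ⟺ SOME `g ∈ Gal(ℍ′_n/K_n(i))` moves `P(n)`** (⟸ any mover: g4's door; ⟹ `g₀` itself, `…GenusCharacter` §4).

What this buys the line (LEAD census, crux 20509): the jump-one class splits by the DESCENT invariant `ρ(n)`: on `{ρ = 1}` the upper half
of C⁺ is a Layer-1 statement of the extended kind («`P(n) ∉ A(K_n(i))`», decidable by ONE Galois motion, BSD₂-predicted to hold on every
G-member); on `{ρ = 0}` it is NOT a Galois-motion statement inside `ℍ′_n` at all (given the lower half, `P(n)` is `Gal(ℍ′_n/K_n(i))`-fixed,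
G- and B-locus alike) — there the beyond-print input must be a genuine depth-2 datum (g4's square class of `X_A(W′)`, or a Kolyvagin prime).
Beyond-print theorem: NO; C⁺ stays open; BSD is not proved by any of this; no class is closed by this file.

References: [cite: TianYuanZhang2017, §1 (p0002 L101–L110: ρ(n)), Thm. 3.5 (p0011 L94–L100), §3.1 (p0011 L27–L36), Lemma 3.18
(p0017 L152–L153)]; [cite: SilvermanAEC2009, Prop. X.4.9]; [cite: Darmon2004, Thm. 3.22] (GZK); tree: `…LevelTwoRhoValve` (p664829),
`…GaloisMotion` (p671505), `…GenusCharacter` (p726538), W2 kernel `TianYuanZhang2017/GenusDescent{EnSide,Twist}.lean`.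
-/

noncomputable section

open scoped Classical

open WeierstrassCurve WeierstrassCurve.Affine Literature.NumberTheory.EllipticCurves
  Literature.NumberTheory.EllipticCurves.Rank1Residual Summit.BirchSwinnertonDyer.Rank1Residual
  Literature.NumberTheory.EllipticCurves.TianYuanZhang2017
  Literature.NumberTheory.EllipticCurves.TianYuanZhang2017.W2
  Summit.BirchSwinnertonDyer.PrintCf2.LevelTwoHalfGenerator
  Summit.BirchSwinnertonDyer.PrintCf2.GaloisMotion
  Summit.BirchSwinnertonDyer.PrintCf2.LevelTwoHalves
  Summit.BirchSwinnertonDyer.PrintCf2.LevelTwoGenusQuotient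
  Summit.BirchSwinnertonDyer.PrintCf2.GenusCharacter
  Summit.BirchSwinnertonDyer.Rank1Residual.P2.ThetaDescent

set_option autoImplicit false

namespace Summit.BirchSwinnertonDyer.PrintCf2.GenusCharacterRho

variable {n : ℕ}

/-! ## §1 `ρ(n) = 0` ⟹ the half-generator is fixed by `Gal(ℍ′_n/K_n(i))` -/

/-- **`ρ(n) = 0` FREEZES THE HALF.** Square-free ODD `n` with `rank E_n(ℚ) ≤ 1` and `[E_n(ℚ) : φ_n(A_n(ℚ)) + E_n[2]] = 1`; data `D`
with Lemma 3.18; `R` a generator of `E_n(ℚ)` modulo torsion and `Q₁ ∈ A(ℍ′_n)` any half of its twist.  Then `g·Q₁ = Q₁` for every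
`g ∈ Aut_ℚ(ℍ′_n)` fixing `i` and `√−n` (`Q₁ ≡ ±ι Θ_A(α₀)` modulo torsion, half relation at `ρ = 0`; `ι Θ_A(α₀)` comes from `K_n`; the
torsion is `g`-fixed). [cite: TianYuanZhang2017, §1 (p0002 L101–L110), §3.1 (p0011 L27–L36), Lemma 3.18 (p0017 L152–L153)] -/
theorem galPt_half_eq_of_rhoIndex_eq_one (hsq : Squarefree n) [(congruentNumberCurve n).IsElliptic] (hodd : Odd n)
    (hr1 : (congruentNumberCurve n).mordellWeilRank ≤ 1) (D : GenusPointData n) (h318 : D.lemma318)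
    (hρ0 : (rhoSubgroup n).index = 1)
    {R : (congruentNumberCurve n).toAffine.Point} (hR : ∀ x, ∃ k : ℤ, IsOfFinAddOrder (x - k • R))
    {Q₁ : APoint D.H} (hQ₁ : φH D Q₁ = Point.map (W' := curveA.twoIsogenyCodomain)
      (D.embK n (Nat.mem_divisors_self n hsq.ne_zero)) (ΘE hsq.ne_zero R))
    (g : D.H ≃ₐ[ℚ] D.H) (hgi : g D.im = D.im) (hgK : g (D.sqrtNeg n) = D.sqrtNeg n) :
    D.galPt g Q₁ = Q₁ := by
  have hn0 : n ≠ 0 := hsq.ne_zero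
  have hn : n ∈ n.divisors := Nat.mem_divisors_self n hn0
  obtain ⟨α₀, hα₀⟩ := stub_S0' (n := n) hr1
  have hρ : (rhoSubgroup n).index = 2 ^ 0 := by simpa using hρ0
  obtain ⟨ε, hε, t₂, ht₂, hψα⟩ := stub_S1 hsq (ψQ n) xSqClass_eq_one_iff_exists_ψQ hρ hR hα₀
  have key := LevelTwoRhoValve.map_ΘA_sub_zsmul_half_isOfFinAddOrder hsq D ht₂ hψα hQ₁
  rw [pow_zero, mul_one] at key
  have hε2 : ε * ε = 1 := by rcases hε with rfl | rfl <;> norm_num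
  -- `Q₁ = ε·ιΘ_A(α₀) − ε·(ιΘ_A(α₀) − ε Q₁)`
  set X := Point.map (W' := curveA) (D.embK n hn) (ΘA hn0 α₀) with hX
  have hgX : D.galPt g X = X := by
    rw [hX, GenusPointData.galPt, Point.map_map, algHom_comp_embK_eq D hn g hgK]
  have hfix : D.galPt g (X - ε • Q₁) = X - ε • Q₁ := galPt_eq_self_of_isOfFinAddOrder D hodd h318 g hgi key
  have eQ : Q₁ = ε • X - ε • (X - ε • Q₁) := by
    rw [smul_sub, smul_smul, hε2, one_smul]; abel
  rw [eQ, map_sub, map_zsmul, map_zsmul, hgX, hfix]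

/-! ## §2 On the line with `ρ(n) = 0`, `Gal(ℍ′_n/K_n(i))` fixes the genus point -/

/-- **`ρ(n) = 0` and `P(n) ≡ m·Q₁` ⟹ every `g` fixing `i` and `√−n` fixes `P(n)`** (square-free odd `n`, rank `≤ 1`, Lemma 3.18).
[cite: TianYuanZhang2017, §1 (p0002 L101–L110), Lemma 3.18 (p0017 L152–L153)] -/
theorem galPt_genusPoint_eq_of_rhoIndex_eq_one_of_mem_line (hsq : Squarefree n) [(congruentNumberCurve n).IsElliptic]
    (hodd : Odd n) (hr1 : (congruentNumberCurve n).mordellWeilRank ≤ 1) (D : GenusPointData n) (h318 : D.lemma318)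
    (hρ0 : (rhoSubgroup n).index = 1)
    {R : (congruentNumberCurve n).toAffine.Point} (hR : ∀ x, ∃ k : ℤ, IsOfFinAddOrder (x - k • R))
    {Q₁ : APoint D.H} (hQ₁ : φH D Q₁ = Point.map (W' := curveA.twoIsogenyCodomain)
      (D.embK n (Nat.mem_divisors_self n hsq.ne_zero)) (ΘE hsq.ne_zero R))
    {m : ℤ} (hm : IsOfFinAddOrder (D.P n - m • Q₁))
    (g : D.H ≃ₐ[ℚ] D.H) (hgi : g D.im = D.im) (hgK : g (D.sqrtNeg n) = D.sqrtNeg n) :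
    D.galPt g (D.P n) = D.P n :=
  galPt_genusPoint_eq_of_half_fixed_of_mem_line D hodd h318 g hgi
    (galPt_half_eq_of_rhoIndex_eq_one hsq hodd hr1 D h318 hρ0 hR hQ₁ g hgi hgK) hm

/-- **ON THE LOWER-HALF LOCUS WITH `ρ(n) = 0`, `Gal(ℍ′_n/K_n(i))` FIXES `P(n)`.** Square-free odd `n ≡ 5, 7 (mod 8)` of analytic rank
one; GZK; data with Thm 3.5, integrality, Lemma 3.18; `ρ(n) = 0`; `2 ∣ L` for every sign choice `L` of `𝓛(n)`.  Then `g·P(n) = P(n)`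
for every `g ∈ Aut_ℚ(ℍ′_n)` fixing `i` and `√−n`. [cite: TianYuanZhang2017, Thm. 3.5 (p0011 L94–L100), §1 (p0002 L101–L110)] [cite: Darmon2004, Thm. 3.22] -/
theorem galPt_genusPoint_eq_of_rhoIndex_eq_one_of_two_dvd
    (hGZK : rank_eq_analyticRank_of_analyticRank_le_one) (hsq : Squarefree n)
    (h8 : n % 8 = 5 ∨ n % 8 = 7) (hr : (congruentNumberCurve n).analyticRank = 1)
    (D : GenusPointData n) (h35 : D.thm35Main) (hLs : D.scriptLSpec) (h318 : D.lemma318)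
    (hρ0 : (rhoSubgroup n).index = 1) (h2 : ∀ L : ℤ, IsScriptL n L → (2 : ℤ) ∣ L)
    (g : D.H ≃ₐ[ℚ] D.H) (hgi : g D.im = D.im) (hgK : g (D.sqrtNeg n) = D.sqrtNeg n) :
    D.galPt g (D.P n) = D.P n := by
  haveI := isElliptic_congruentNumberCurve hsq.ne_zero
  have hodd : Odd n := by rcases h8 with h | h <;> exact Nat.odd_iff.mpr (by omega)
  have h8' : n % 8 = 5 ∨ n % 8 = 6 ∨ n % 8 = 7 := by rcases h8 with h | h <;> omega
  have hn : n ∈ n.divisors := Nat.mem_divisors_self n hsq.ne_zero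
  have hrank : (congruentNumberCurve n).mordellWeilRank = 1 := (hGZK _ hr.le).1.trans hr
  obtain ⟨R, hR⟩ := stub_S0 (n := n) hrank.le
  obtain ⟨Q₁, hQ₁⟩ := twist_halving hsq hn D R
  obtain ⟨m, hm⟩ := (two_dvd_scriptL_iff_genusPoint_mem_line hGZK hsq h8' hr D h35 hLs hR hQ₁).mp h2
  exact galPt_genusPoint_eq_of_rhoIndex_eq_one_of_mem_line hsq hodd hrank.le D h318 hρ0 hR hQ₁ hm g hgi hgK

/-- **Hence no Galois-motion door inside `ℍ′_n` fires on `{ρ = 0} ∩ {2 ∣ 𝓛}`**: there is NO `g ∈ Aut_ℚ(ℍ′_n)` fixing `i` and `√−n`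
with `g·P(n) ≠ P(n)` (same data). [cite: TianYuanZhang2017, Thm. 3.5 (p0011 L94–L100), §1 (p0002 L101–L110)] [cite: Darmon2004, Thm. 3.22] -/
theorem not_exists_galPt_genusPoint_ne_of_rhoIndex_eq_one_of_two_dvd
    (hGZK : rank_eq_analyticRank_of_analyticRank_le_one) (hsq : Squarefree n)
    (h8 : n % 8 = 5 ∨ n % 8 = 7) (hr : (congruentNumberCurve n).analyticRank = 1)
    (D : GenusPointData n) (h35 : D.thm35Main) (hLs : D.scriptLSpec) (h318 : D.lemma318)
    (hρ0 : (rhoSubgroup n).index = 1) (h2 : ∀ L : ℤ, IsScriptL n L → (2 : ℤ) ∣ L) :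
    ¬ ∃ g : D.H ≃ₐ[ℚ] D.H, g D.im = D.im ∧ g (D.sqrtNeg n) = D.sqrtNeg n ∧ D.galPt g (D.P n) ≠ D.P n := by
  rintro ⟨g, hgi, hgK, hne⟩
  exact hne (galPt_genusPoint_eq_of_rhoIndex_eq_one_of_two_dvd hGZK hsq h8 hr D h35 hLs h318 hρ0 h2 g hgi hgK)

/-- **C⁺ with `ρ(n) = 0` ⟹ `P(n)` is fixed by `Gal(ℍ′_n/K_n(i))`** (C⁺ contains the lower half). On the whole of `{ρ = 0}` ∩ jump-one,
BSD₂ therefore predicts a `K_n(i)`-fixed genus point. [cite: TianYuanZhang2017, Thm. 3.5 (p0011 L94–L100), §1 (p0002 L101–L110)] [cite: Darmon2004, Thm. 3.22] -/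
theorem galPt_genusPoint_eq_of_rhoIndex_eq_one_of_levelTwo
    (hGZK : rank_eq_analyticRank_of_analyticRank_le_one) (hsq : Squarefree n)
    (h8 : n % 8 = 5 ∨ n % 8 = 7) (hr : (congruentNumberCurve n).analyticRank = 1)
    (D : GenusPointData n) (h35 : D.thm35Main) (hLs : D.scriptLSpec) (h318 : D.lemma318)
    (hρ0 : (rhoSubgroup n).index = 1) (hC : ∀ L : ℤ, IsScriptL n L → (2 : ℤ) ∣ L ∧ ¬ (4 : ℤ) ∣ L)
    (g : D.H ≃ₐ[ℚ] D.H) (hgi : g D.im = D.im) (hgK : g (D.sqrtNeg n) = D.sqrtNeg n) :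
    D.galPt g (D.P n) = D.P n :=
  galPt_genusPoint_eq_of_rhoIndex_eq_one_of_two_dvd hGZK hsq h8 hr D h35 hLs h318 hρ0 (fun L hL => (hC L hL).1) g hgi hgK

/-! ## §3 With a half-mover (ρ(n) = 1 by Galois theory), C⁺ on the lower-half locus ⟺ SOME Galois motion of `P(n)` -/

/-- **LOWER HALF + A HALF-MOVER: C⁺ ⟺ ∃ mover of `P(n)` in the stabiliser of `i`, `√−n`.**  Square-free odd `n ≡ 5, 7 (mod 8)` of analytic
rank one; GZK; data with Thm 3.5, integrality, Lemma 3.18; `R` a generator of `E_n(ℚ)` mod torsion, `Q₁` a half of its twist; `2 ∣ L` for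
every sign choice; and SOME `g₀ ∈ Aut_ℚ(ℍ′_n)` fixing `i`, `√−n` with `g₀·Q₁ ≠ Q₁` (supplied by `ρ(n) = 1`).  Then the conclusion of C⁺
at `n` holds iff SOME `g ∈ Aut_ℚ(ℍ′_n)` fixing `i` and `√−n` moves `P(n)`.
[cite: TianYuanZhang2017, Thm. 3.5 (p0011 L94–L100), Lemma 3.18 (p0017 L152–L153)] [cite: Darmon2004, Thm. 3.22] -/
theorem levelTwo_iff_exists_galPt_genusPoint_ne_of_two_dvd
    (hGZK : rank_eq_analyticRank_of_analyticRank_le_one) (hsq : Squarefree n)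
    (h8 : n % 8 = 5 ∨ n % 8 = 7) (hr : (congruentNumberCurve n).analyticRank = 1)
    (D : GenusPointData n) (h35 : D.thm35Main) (hLs : D.scriptLSpec) (h318 : D.lemma318)
    {R : (congruentNumberCurve n).toAffine.Point} (hR : ∀ x, ∃ k : ℤ, IsOfFinAddOrder (x - k • R))
    {Q₁ : APoint D.H} (hQ₁ : φH D Q₁ = Point.map (W' := curveA.twoIsogenyCodomain)
      (D.embK n (Nat.mem_divisors_self n hsq.ne_zero)) (ΘE hsq.ne_zero R))
    (h2 : ∀ L : ℤ, IsScriptL n L → (2 : ℤ) ∣ L)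
    {g₀ : D.H ≃ₐ[ℚ] D.H} (hg₀i : g₀ D.im = D.im) (hg₀K : g₀ (D.sqrtNeg n) = D.sqrtNeg n)
    (hmoveQ : D.galPt g₀ Q₁ ≠ Q₁) :
    (∀ L : ℤ, IsScriptL n L → (2 : ℤ) ∣ L ∧ ¬ (4 : ℤ) ∣ L) ↔
      ∃ g : D.H ≃ₐ[ℚ] D.H, g D.im = D.im ∧ g (D.sqrtNeg n) = D.sqrtNeg n ∧ D.galPt g (D.P n) ≠ D.P n := by
  haveI := isElliptic_congruentNumberCurve hsq.ne_zero
  constructor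
  · intro hC
    exact ⟨g₀, hg₀i, hg₀K, (levelTwo_iff_galPt_genusPoint_ne_of_two_dvd hGZK hsq h8 hr D h35 hLs h318 hR hQ₁ h2
      g₀ hg₀i hg₀K hmoveQ).mp hC⟩
  · rintro ⟨g, hgi, hgK, hne⟩ L hL
    exact ⟨h2 L hL, not_four_dvd_of_galPt_genusPoint_ne hGZK hsq h8 hr D h35 hLs h318 g hgi hgK hne L hL⟩

end Summit.BirchSwinnertonDyer.PrintCf2.GenusCharacterRho

end
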